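import Summits.BirchSwinnertonDyer.BirchSwinnertonDyer.Theorems.SylvesterTwoHeegnerIndexThmCCubicTwistDescent
import HarnessLib

/-!
# Route `SylvesterTwoHeegnerIndex` (rung K7t), THEOREM C step (C-d): the DESCENT STEP made KERNEL —
# from `σR′ = [ω]R′ + t′` (`t′ ∈ E₁[√−3]`) to `Y′ ∈ E_p` fixed by `σ` with `Y ≡ 2Y′` modulo `E_p[3]`

HONEST FRAMING (cell b2b-bsdres, seat x1b GEN 51 = O12 class lead; file `--supports
stmt-BirchSwinnertonDyer-19802 --as helper`, the K7t crux r201 `HSYPointTwoDivisibleSevenModNine` =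
the cell's THEOREM C). Sequel of `…ThmCCubicTwistDescent.lean` (the cubic-twist identification
`E₁(L)^{σ = [ω]} ≅ E_p(L)^σ`, §§0–2 there). MEMO-bsd-cm-two v2.8 §15.5 (C-d), after the trace doubling
`R₁ = 2R₁′` (kernel, x1b GEN 49 `sum_smul_eq_two_nsmul_of_involution_fixes`) and Hu–Shu–Yin's printed laws
(Thm 2.3 (1): `R′ := φ(R₁′) ∈ E₁(L_{(p)})`; Cor 2.5: `R′^{σ_{ω₃}} = [ω]R′ + t′`, `t′ ∈ ⟨(0, 12√−3)⟩`), reads: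
«since `T ↦ T − [ω]T` maps `E₁[3]` onto `E₁[√−3]` there is `T′ ∈ E₁[3](K)` with
`Y′ := φ′(R′ − T′) ∈ E₁(L_{(p)})^{σ_{ω₃} = ω} ≅ E_p(K)`. Then `Y = φ′(R − T) = 2Y′ + φ′(2T′ − T)` and
`φ′(2T′ − T) = Y − 2Y′ ∈ E_p(K) ∩ E_p[3]`. Hence `Y ≡ 2Y′` in `E_p(K)/tors`.» This file makes exactly that
passage KERNEL and DEF-FREE (the two printed laws enter as the HYPOTHESIS `hR′`; the Galois descent
`E_p(L)^{⟨σ⟩} = E_p(K)` is the tree's `exists_map_eq_of_forall_map_galois_eq`, applied in the sequel):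

* §3 additive algebra in any abelian groups: `s(R′ − T′) = θ(R′ − T′)` from `sR′ = θR′ + t′`,
  `T′ − θT′ = t′`, `sT′ = T′` (`map_sub_eq_rootMul_sub`); `φ(R − T) − 2•φ(R′ − T′) = φ(2•T′ − T)` for
  `R = 2•R′`, which is `3`-torsion when `T, T′` are (`twistMap_sub_two_nsmul`,
  `three_nsmul_twistMap_sub_two_nsmul`, `isOfFinAddOrder_twistMap_sub_two_nsmul`);
* §4 on `E₁ : y² = x³ − 432` over a field `L ∋ ω` (`2, 3 ≠ 0`) with `σ ω = ω`: EVERY `3`-torsion point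
  is fixed by `σ` (`map_eq_self_of_three_nsmul_eq_zero` — by x1b GEN 50's classification
  `eq_of_three_nsmul_eq_zero` the coordinates lie in `ℚ(ω)`), hence
  **`exists_threeTorsion_map_sub_eq_omegaRot_sub`** (`T′` from GEN 50's ONTO lemma
  `exists_threeTorsion_sub_omegaRot_eq`) and **`thmC_descent_step`**: `Y′ := φ(R′ − T′)` is `σ`-FIXED
  and `3•(φ(2•R′ − T) − 2•Y′) = 0`.

NO definition, NO named fact, NO sorry; axioms standard. WHAT THIS IS NOT: not THEOREM C (its
Shimura-reciprocity steps (C-a), (C-b)₁, (C-b)₂ and the two printed laws stay PRINT/CELL, memo §40.2);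
nothing about `Ш`; closes no item; nothing booked; no label moves.
References: MEMO-bsd-cm-two v2.8 §15.5 (C-d), §40.1; [HuShuYin2019] pp. 7–8; [SilvermanAEC2009] X.5.4.
-/

set_option autoImplicit false
-- the Summit-side namespace `Summit.BirchSwinnertonDyer.BirchSwinnertonDyer.…` (summit = problem) is mandated by D-0017
set_option linter.dupNamespace false

noncomputable section

open scoped Classical

open WeierstrassCurve WeierstrassCurve.Affine WeierstrassCurve.Affine.Point

namespace Summit.BirchSwinnertonDyer.BirchSwinnertonDyer.Theorems.SylvesterTwoThmCTwist

open SylvesterTwoCMNormForm SylvesterTwoThmCTorsion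

variable {L : Type*} [Field L]

/-! ## §3 The (C-d) endgame as additive algebra -/

section Endgame

variable {A B : Type*} [AddCommGroup A] [AddCommGroup B]

/-- **From `σR′ = [ω]R′ + t′` to the eigen-relation for `R′ − T′`**: if `s R′ = θ R′ + t′`,
`T′ − θ T′ = t′` and `s T′ = T′` (additive `s, θ`), then `s(R′ − T′) = θ(R′ − T′)` — the memo's
«there is `T′ ∈ E₁[3](K)` with `Y′ := φ′(R′ − T′) ∈ E₁(L_{(p)})^{σ_{ω₃} = ω}`»; the witness `T′` with
`T′ − [ω]T′ = t′` is x1b GEN 50's `SylvesterTwoThmCTorsion.exists_threeTorsion_sub_omegaRot_eq`.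
[cite: HuShuYin2019, p. 8] -/
theorem map_sub_eq_rootMul_sub (s θ : A →+ A) {R' T' t' : A} (hR' : s R' = θ R' + t')
    (ht' : T' - θ T' = t') (hT' : s T' = T') : s (R' - T') = θ (R' - T') := by
  rw [map_sub, map_sub, hR', hT', ← ht']
  abel

/-- **`Y − 2Y′ = φ(2T′ − T)`**: for additive `φ` and `R = 2•R′`,
`φ(R − T) − 2•φ(R′ − T′) = φ(2•T′ − T)` (memo §15.5 (C-d): «`Y = φ′(R − T) = 2Y′ + φ′(2T′ − T)`»).
[cite: HuShuYin2019, p. 8] -/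
theorem twistMap_sub_two_nsmul (φ : A →+ B) {R R' T T' : A} (hR : R = (2 : ℕ) • R') :
    φ (R - T) - (2 : ℕ) • φ (R' - T') = φ ((2 : ℕ) • T' - T) := by
  subst hR
  simp only [map_sub, map_nsmul, smul_sub]
  abel

/-- **`Y − 2Y′ ∈ E_p[3]`**: with `T, T′` `3`-torsion, `3•(φ(R − T) − 2•φ(R′ − T′)) = 0`
(memo: «`φ′(2T′ − T) = Y − 2Y′ ∈ E_p(K) ∩ E_p[3]`»). [cite: HuShuYin2019, p. 8] -/
theorem three_nsmul_twistMap_sub_two_nsmul (φ : A →+ B) {R R' T T' : A} (hR : R = (2 : ℕ) • R')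
    (hT : (3 : ℕ) • T = 0) (hT' : (3 : ℕ) • T' = 0) :
    (3 : ℕ) • (φ (R - T) - (2 : ℕ) • φ (R' - T')) = 0 := by
  rw [twistMap_sub_two_nsmul φ hR, ← map_nsmul, smul_sub, smul_smul,
    show (3 * 2 : ℕ) = 2 * 3 from rfl, ← smul_smul, hT', hT, smul_zero, sub_self, _root_.map_zero]

/-- Hence `Y − 2•Y′` has finite order (dividing `3`). [folklore] -/
theorem isOfFinAddOrder_twistMap_sub_two_nsmul (φ : A →+ B) {R R' T T' : A} (hR : R = (2 : ℕ) • R')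
    (hT : (3 : ℕ) • T = 0) (hT' : (3 : ℕ) • T' = 0) :
    IsOfFinAddOrder (φ (R - T) - (2 : ℕ) • φ (R' - T')) :=
  isOfFinAddOrder_iff_nsmul_eq_zero.mpr
    ⟨3, by norm_num, three_nsmul_twistMap_sub_two_nsmul φ hR hT hT'⟩

end Endgame

/-! ## §4 On `E₁ : y² = x³ − 432`: `E₁[3]` is pointwise Galois-fixed, and THE DESCENT STEP -/

section EOne

variable {W W' : WeierstrassCurve L} {ω c : L} {σ : L →+* L}
  (hω : ω ^ 2 + ω + 1 = 0) (h2L : (2 : L) ≠ 0) (h3L : (3 : L) ≠ 0) (hc0 : c ≠ 0)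
  (h1 : W.a₁ = 0) (h2 : W.a₂ = 0) (h3 : W.a₃ = 0) (h4 : W.a₄ = 0) (h6 : W.a₆ = -432)
  (h1' : W'.a₁ = 0) (h2' : W'.a₂ = 0) (h3' : W'.a₃ = 0) (h4' : W'.a₄ = 0) (h6' : W'.a₆ = c ^ 6 * W.a₆)
  (hσω : σ ω = ω) (hσc : σ c = ω * c)

include h6 in
/-- `σ` fixes `a₆ = −432`. [folklore] -/
theorem map_a₆_EOne : σ W.a₆ = W.a₆ := by
  rw [h6, map_neg, map_ofNat]

variable {s : W.toAffine.Point → W.toAffine.Point} (hs0 : s 0 = 0)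
  (hs : ∀ (x y : L) (h : W.toAffine.Nonsingular x y),
    s (.some x y h) = .some (σ x) (σ y) (nonsingular_map h1 h2 h3 h4 (map_a₆_EOne h6) h))

include hω h2L h3L h6 hσω hs0 hs in
/-- **`E₁[3]` is pointwise Galois-fixed**: every `3`-torsion point of `y² = x³ − 432` over `L ∋ ω` is one
of `𝒪, (0, ±12(2ω+1)), (12ζ, ±36)` (x1b GEN 50 `eq_of_three_nsmul_eq_zero`), whose coordinates lie in
`ℚ(ω)` and are therefore fixed by any `σ` with `σ ω = ω` — the memo's «`T′ ∈ E₁[3](K)`».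
[cite: HuShuYin2019, pp. 7–8] -/
theorem map_eq_self_of_three_nsmul_eq_zero (T : W.toAffine.Point) (hT : (3 : ℕ) • T = 0) : s T = T := by
  rcases T with _ | ⟨x, y, hp⟩
  · exact hs0
  · rw [hs]
    simp only [Affine.Point.some.injEq]
    have hσsqrt : σ (12 * (2 * ω + 1)) = 12 * (2 * ω + 1) := by
      rw [map_mul, map_add, map_mul, map_ofNat, map_ofNat, map_one, hσω]
    rcases eq_of_three_nsmul_eq_zero h2L h3L h1 h2 h3 h4 h6 hω hp hT with ⟨hx, hy⟩ | ⟨hx, hy⟩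
    · refine ⟨by rw [hx, _root_.map_zero], ?_⟩
      rcases hy with hy | hy
      · rw [hy, hσsqrt]
      · rw [hy, map_neg, hσsqrt]
    · refine ⟨?_, ?_⟩
      · rcases hx with hx | hx | hx
        · rw [hx, map_ofNat]
        · rw [hx, map_mul, map_ofNat, hσω]
        · rw [hx, map_mul, map_pow, map_ofNat, hσω]
      · rcases hy with hy | hy
        · rw [hy, map_ofNat]
        · rw [hy, map_neg, map_ofNat]

variable {θ : W.toAffine.Point → W.toAffine.Point} (hθ0 : θ 0 = 0)
  (hθ : ∀ (x y : L) (h : W.toAffine.Nonsingular x y),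
    θ (.some x y h) = .some (ω * x) y (nonsingular_omega_mul hω h1 h2 h3 h4 h))

include hω h2L h3L h6 hσω hs0 hs hθ0 hθ in
/-- **(C-d)₂ + (C-d)₃ COMPOSED**: if `σR′ = [ω]R′ + t′` with `t′ ∈ E₁[√−3] = {𝒪, (0, ±12√−3)}` (Hu–Shu–Yin
Cor 2.5, the HYPOTHESIS `hR′`) and `s, [ω]` are additive, then there is `T′ ∈ E₁[3](L)` — a point FIXED by
`σ` — with `σ(R′ − T′) = [ω](R′ − T′)` (x1b GEN 50's ONTO lemma supplies `T′` with `T′ − [ω]T′ = t′`).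
[cite: HuShuYin2019, p. 8] -/
theorem exists_threeTorsion_map_sub_eq_omegaRot_sub
    (hsadd : ∀ P Q : W.toAffine.Point, s (P + Q) = s P + s Q)
    (hθadd : ∀ P Q : W.toAffine.Point, θ (P + Q) = θ P + θ Q)
    {R' t' : W.toAffine.Point} (hR' : s R' = θ R' + t')
    (ht' : t' = 0 ∨
      t' = .some 0 (12 * (2 * ω + 1)) (nonsingular_zero_twelveSqrt h2L h1 h2 h3 h4 h6 hω h3L) ∨
      t' = .some 0 (-(12 * (2 * ω + 1))) (nonsingular_zero_neg_twelveSqrt h2L h1 h2 h3 h4 h6 hω h3L)) :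
    ∃ T' : W.toAffine.Point, (3 : ℕ) • T' = 0 ∧ s T' = T' ∧ s (R' - T') = θ (R' - T') := by
  obtain ⟨T', hT'3, hT't⟩ :=
    exists_threeTorsion_sub_omegaRot_eq hω h2L h3L h1 h2 h3 h4 h6 hθ hθ0 t' ht'
  have hfix := map_eq_self_of_three_nsmul_eq_zero hω h2L h3L h1 h2 h3 h4 h6 hσω hs0 hs T' hT'3
  refine ⟨T', hT'3, hfix, ?_⟩
  have e := map_sub_eq_rootMul_sub (AddMonoidHom.mk' s hsadd) (AddMonoidHom.mk' θ hθadd) hR' hT't hfix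
  simpa only [AddMonoidHom.mk'_apply] using e

variable {s' : W'.toAffine.Point → W'.toAffine.Point} (hs0' : s' 0 = 0)
  (hs' : ∀ (x y : L) (h : W'.toAffine.Nonsingular x y),
    s' (.some x y h) = .some (σ x) (σ y)
      (nonsingular_map h1' h2' h3' h4'
        (map_a₆_twist h6' (omega_pow_three hω) hσc (map_a₆_EOne h6)) h))
  {φ : W.toAffine.Point → W'.toAffine.Point} (hφ0 : φ 0 = 0)
  (hφ : ∀ (x y : L) (h : W.toAffine.Nonsingular x y),
    φ (.some x y h) = .some (c ^ 2 * x) (c ^ 3 * y) (nonsingular_twist hc0 h1 h2 h3 h4 h1' h2' h3' h4' h6' h))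

include hω h2L h3L hc0 h1 h2 h3 h4 h6 h1' h2' h3' h4' h6' hσω hσc hs0 hs hθ0 hθ hs0' hs' hφ0 hφ in
/-- **THE DESCENT STEP OF THEOREM C, KERNEL** (memo §15.5 (C-d), after `R₁ = 2R₁′` and HSY's printed laws):
on `E₁ : y² = x³ − 432` over a field `L ∋ ω, c` (`c³ = p`, so `E_p : y² = x³ − 432p² = x³ + c⁶a₆`), for a ring
endomorphism `σ` of `L` with `σ ω = ω`, `σ c = ωc` acting coordinatewise (`s`, `s′`), `[ω]` acting by
`(x,y) ↦ (ωx, y)` (`θ`), the cubic-twist scaling `φ : (x,y) ↦ (c²x, c³y)`, all additive: IF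
`σR′ = [ω]R′ + t′` with `t′ ∈ E₁[√−3]` (Hu–Shu–Yin Cor 2.5 — HYPOTHESIS) and `T ∈ E₁[3]`, THEN there are
`T′ ∈ E₁[3]` and `Y′ := φ(R′ − T′)` with **`σ Y′ = Y′`** (so `Y′ ∈ E_p(K)` by Galois descent when
`L^{⟨σ⟩} = K`) and **`3•(Y − 2•Y′) = 0`** for `Y := φ(2•R′ − T)` — «`Y ≡ 2Y′` in `E_p(K)/tors`; … `m ≥ 1`».
[cite: HuShuYin2019, p. 8] -/
theorem thmC_descent_step
    (hsadd : ∀ P Q : W.toAffine.Point, s (P + Q) = s P + s Q)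
    (hθadd : ∀ P Q : W.toAffine.Point, θ (P + Q) = θ P + θ Q)
    (hφadd : ∀ P Q : W.toAffine.Point, φ (P + Q) = φ P + φ Q)
    {R' t' T : W.toAffine.Point} (hR' : s R' = θ R' + t')
    (ht' : t' = 0 ∨
      t' = .some 0 (12 * (2 * ω + 1)) (nonsingular_zero_twelveSqrt h2L h1 h2 h3 h4 h6 hω h3L) ∨
      t' = .some 0 (-(12 * (2 * ω + 1))) (nonsingular_zero_neg_twelveSqrt h2L h1 h2 h3 h4 h6 hω h3L))
    (hT : (3 : ℕ) • T = 0) :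
    ∃ T' : W.toAffine.Point, (3 : ℕ) • T' = 0 ∧ s' (φ (R' - T')) = φ (R' - T') ∧
      (3 : ℕ) • (φ ((2 : ℕ) • R' - T) - (2 : ℕ) • φ (R' - T')) = 0 := by
  obtain ⟨T', hT'3, -, hrel⟩ := exists_threeTorsion_map_sub_eq_omegaRot_sub hω h2L h3L h1 h2 h3 h4 h6
    hσω hs0 hs hθ0 hθ hsadd hθadd hR' ht'
  refine ⟨T', hT'3, ?_, ?_⟩
  · exact (map_twistMap_eq_self_iff hc0 h1 h2 h3 h4 h1' h2' h3' h4' h6' hφ0 hφ (omega_pow_three hω) hσc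
      (map_a₆_EOne h6) hs0 hs hs0' hs' hθ0 hθ (R' - T')).mpr hrel
  · have e := three_nsmul_twistMap_sub_two_nsmul (AddMonoidHom.mk' φ hφadd) (R := (2 : ℕ) • R') rfl hT hT'3
    simpa only [AddMonoidHom.mk'_apply] using e

end EOne

end Summit.BirchSwinnertonDyer.BirchSwinnertonDyer.Theorems.SylvesterTwoThmCTwist

end
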